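import Literature.AlgebraicGeometry.HodgeTheory.MotivatedClasses
import Literature.AlgebraicGeometry.HodgeTheory.GysinKernelProofs
import Literature.AlgebraicGeometry.HodgeTheory.GysinFormalismCorrespondences
import Literature.AlgebraicGeometry.HodgeTheory.HardLefschetzNFold
import Literature.AlgebraicGeometry.HodgeTheory.SupportedHodgeClassesAlgebraic
import Literature.AlgebraicGeometry.Motives.ComplexPointsOrientation
import HarnessLib

/-!
# Algebraic classes are motivated: `A(X) ⊆ A_mot(X)` on the real carriers, and the graph formalism `f^* = [Γ_f]^*`, `f_* = [ᵗΓ_f]^*` (André 1996, §2.1)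

Family `hodge`, layer `Literature/AlgebraicGeometry/HodgeTheory`. Companion (theorems only) of
`MotivatedClasses.lean`, which puts André's motivated classes `A_motᵖ(X)_ℂ` (Y. André, *Pour une
théorie inconditionnelle des motifs*, Publ. Math. IHÉS 83 (1996), §2.1 Déf. 1) on the real carriers
`H²ᵖ(X(ℂ); ℂ)` as the span `motivatedClasses n X p` of the classes `pr_{X*}(α ∪ *_L β)`, and lists
among the theorems NOT there: "`A(X) ⊆ A_mot(X)` (« il est clair » — needs an orientation of `X(ℂ)`
with Poincaré duality, a polarisation class […])". This file proves it.

Source, verbatim (André 1996, §2.1, remark following Déf. 1, p. 14): "Il est clair que `A_mot(X)_E`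
contient `A(X)` et `*A(X)`". It is the first step of every construction of motivated cycles in the
paper, in particular of the proof of Thm. 0.6.2 (§6.3, p. 33: the global section of Lemme 6.3.3
(iii) has an ALGEBRAIC fibre at `s₀`, hence a motivated one, which Thm. 0.5 then deforms).

## The proof on the real carriers

For `X` smooth projective of dimension `n` and `c ∈ Nᵖ H²ᵖ(X(ℂ); ℂ) = algebraicClasses X p`, take in
Déf. 1 the auxiliary variety `Y := X`, the algebraic classes `α := pr₁^* c ∈ Nᵖ H²ᵖ((X ⊗ X)(ℂ))`
(flat pull-back preserves the coniveau, Hartshorne III Prop. 9.5) and `β := Δ_* 1 ∈ Nⁿ H²ⁿ((X ⊗ X)(ℂ))`,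
the Gysin image of `1 ∈ H⁰(X(ℂ))` under the diagonal `Δ : X ⟶ X ⊗ X` (a Gysin image dies off the
image, Fulton App. B §B.2 Ex. 5, here the tree's PROVED `gysinMap_restrictCompl_eq_zero_of_field`;
the diagonal has codimension `n`). In the middle degree `2n = dim_ℝ (X ⊗ X)(ℂ) / 2` André's
Lefschetz involution is `L⁰ = id` (`lefschetzInvolution_apply_of_le`), so the generator is
`pr_{1*}(pr₁^* c ∪ Δ_* 1) = c ∪ pr_{1*} Δ_* 1 = c ∪ (Δ ≫ pr₁)_* 1 = c ∪ 𝟙_* 1 = c ∪ 1 = c`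
(projection formula, functoriality of Gysin maps, Fulton App. B §B.1 (2), (5), (6) — the tree's
`complexGysin_cup`, `complexGysin_comp`, `complexGysin_id`; `cupProduct_one`). The orientations are
any `ℂ`-orientations of the closed manifolds `X(ℂ)`, `(X ⊗ X)(ℂ)` (they exist:
`Motives.ComplexPoints.isOrientableOver`, Hatcher p. 235 with Milnor–Stasheff §13), which satisfy
Poincaré duality unconditionally (`OrientationFamily.hasPoincareDuality`, Hatcher Thm. 3.30, proved
in the tree). The only hypothesis left is the polarisation class of `X ⊗ X` that Déf. 1 requires
(hard Lefschetz; the tree's named fact `nonempty_hardLefschetzNFold`, Voisin I Thm. 6.25), under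
which `A(X) ⊆ A_mot(X)` is stated in the second form below.

## Main statements (all proved)

* `fst_left_flat`, `map_fst_mem_supportedClasses`: `pr_W : W ⊗ X → W` is flat and `pr_W^*`
  preserves the support filtration `Nᶜ Hᵃ` (the `pr_X`-versions are the tree's `snd_left_flat`,
  `map_snd_mem_supportedClasses`).
* `isMotivatedClass_of_mem_algebraicClasses`: for `p ≤ n`, every algebraic class is one of André's
  generators `pr_{X*}(α ∪ *_L β)` (with `Y = X`).
* `algebraicClasses_le_motivatedClasses`: `algebraicClasses X p ≤ motivatedClasses n X p`, given a
  polarisation class of `X ⊗ X`; `algebraicClasses_le_motivatedClasses_of_nonempty_hardLefschetzNFold`: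
  the same from the named fact `nonempty_hardLefschetzNFold (n + n) (X ⊗ X)`
  (`HardLefschetzNFold.isPolarizationClass`: a hard Lefschetz datum is a polarisation class).
* `Andre1996_deformation.map_fiber_mem_motivatedClasses_of_mem_algebraicClasses`: the way Thm. 0.5
  enters the proof of Thm. 0.6.2 (§6.3, p. 33) — granted the named fact `Andre1996_deformation`, a
  global class of a smooth projective family over a reduced connected base whose restriction to ONE
  fibre is algebraic restricts to a MOTIVATED class on EVERY fibre.
* `complexGysin_graph_one_mem_algebraicClasses`, `complexGysin_transposeGraph_one_mem_algebraicClasses`: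
  the graph classes `[Γ_f] = (𝟙, f)_* 1 ∈ Nⁿ H²ⁿ((X' ⊗ X)(ℂ))` and `[ᵗΓ_f] = (f, 𝟙)_* 1 ∈ Nⁿ H²ⁿ((X ⊗ X')(ℂ))`
  of `f : X' ⟶ X` (`dim X = n`) are algebraic (Gysin images are supported on the image, the tree's
  `complexGysin_mem_supportedClasses`, Fulton App. B §B.2 Ex. 5, §B.3).
* `corrClassAction_graph`, `isAlgebraicCorrespondence_map`; `corrClassAction_transposeGraph`,
  `isAlgebraicCorrespondence_complexGysin`: **the graph formalism** of André §2.1 (p. 15: "On obtient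
  le formalisme `f^*`, `f_*` (pour un morphisme `f`) en composant les correspondances motivées avec la
  classe du graphe de `f` ou sa transposée") on the real carriers — `[Γ_f]^* = pr_{X'*}(pr_X^*(·) ∪
  (𝟙, f)_* 1) = f^*` and `[ᵗΓ_f]^* = f_*` for the action `corrClassAction` of `MotivatedClasses.lean`
  (Voisin II (10.7)), so `f^*` and `f_*` are algebraic correspondences (`IsAlgebraicCorrespondence`).
  This is the half of the second ingredient of §6.3 (p. 33: "les cycles motivés sont aussi préservés
  par image inverse par un morphisme") that the tree can carry; the other half — motivated
  correspondences compose (Prop. 2.1 and its Corollaire, through Lemme 1.3.2 and Künneth) — is not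
  in the tree on the real carriers.

## References

* [Andre1996Motifs] Y. André, Publ. Math. IHÉS 83 (1996) 5–49: §2.1 Déf. 1 and the remark following
  it (p. 14), Prop. 2.1, Corollaire and the graph formalism (p. 15); §6.3 (p. 33).
* [FultonYoungTableaux1997] W. Fulton, Young Tableaux, CUP 1997, App. B §B.1 (2), (5), (6), §B.2 Ex. 5,
  §B.3.
* [VoisinHodgeII2003] C. Voisin, Hodge Theory and Complex Algebraic Geometry II, CUP 2003, proof of
  Lemma 9.18, proof of Thm. 10.17 (10.7).
* [Hartshorne1977] R. Hartshorne, Algebraic Geometry, GTM 52, III Prop. 9.2 (b), Prop. 9.5.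
* [HatcherAT2002] A. Hatcher, Algebraic Topology, CUP 2002, §3.2 p. 211, §3.3 Thm. 3.30, p. 235.
* [VoisinHodgeI2002] C. Voisin, Hodge Theory and Complex Algebraic Geometry I, Thm. 6.25, Rem. 6.27.
-/

noncomputable section

open CategoryTheory AlgebraicGeometry MonoidalCategory CartesianMonoidalCategory
open Literature.AlgebraicTopology.SingularHomology Literature.Geometry.Kaehler

namespace Literature.AlgebraicGeometry.HodgeTheory

section HodgeTheory

/-! ### Flat pull-back along the first projection -/

section FirstProjection

variable {m n : ℕ} {W X : Motives.SchemeOver ℂ}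

variable (W X) in
/-- The first projection `pr_W : W ⊗ X → W` is flat (base change of `X → Spec ℂ`, flat over a
field; the `pr_X`-version is the tree's `snd_left_flat`). [cite: Hartshorne1977, III Prop. 9.2 (b)] -/
theorem fst_left_flat : Flat (fst W X).left := by
  change Flat (Limits.pullback.fst W.hom X.hom)
  haveI : Subsingleton ↥(Spec (CommRingCat.of ℂ)) := inferInstanceAs (Subsingleton (PrimeSpectrum ℂ))
  exact MorphismProperty.pullback_fst _ _ inferInstance

/-- **Pull-back along `pr_W : W ⊗ X → W` respects the support filtration**:
`pr_W^*(Nᶜ Hᵃ(W(ℂ))) ⊆ Nᶜ Hᵃ((W ⊗ X)(ℂ))` — a class vanishing off the closed `S ⊆ W` pulls back to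
a class vanishing off `pr_W⁻¹(S)`, whose points have codimension `≥ c`, `pr_W` being flat
(`codim x ≥ codim f(x)` along a flat morphism, Hartshorne III Prop. 9.5; the `pr_X`-version is the
tree's `map_snd_mem_supportedClasses`). In Prop. 9.21's proof: "`cl(Y × Z) = p_2^* cl(Z)`".
[cite: Hartshorne1977, III Prop. 9.5] [cite: VoisinHodgeII2003, proof of Prop. 9.21 (i)] -/
theorem map_fst_mem_supportedClasses (hW : Motives.IsSmoothProjective m W)
    (hX : Motives.IsSmoothProjective n X) {a c : ℕ} {x : complexBetti W a}
    (hx : x ∈ supportedClasses W a c) :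
    complexBetti.map (fst W X) a x ∈ supportedClasses (W ⊗ X) a c := by
  haveI := fst_left_flat W X
  haveI := Motives.IsSmoothProjective.isLocallyNoetherian_holds hW
  haveI := Motives.IsSmoothProjective.isLocallyNoetherian_holds
    (Motives.IsSmoothProjective.tensor_holds hW hX)
  suffices h : supportedClasses W a c ≤
      (supportedClasses (W ⊗ X) a c).comap (complexBetti.map (fst W X) a).hom from h hx
  refine iSup_le fun S ↦ iSup_le fun hS ↦ iSup_le fun hc ↦ fun z hz ↦ ?_
  rw [LinearMap.mem_ker] at hz
  refine mem_supportedClasses_of_restrictCompl_eq_zero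
    (hS.preimage (fst W X).left.base.hom.continuous)
    (fun w hw ↦ (hc _ hw).trans (coheight_base_le_of_flat (fst W X).left w)) ?_
  exact complexBetti.restrictCompl_map_eq_zero (fst W X) hz

end FirstProjection

/-! ### `A(X) ⊆ A_mot(X)` -/

section Motivated

variable {n : ℕ} {X : Motives.SchemeOver ℂ}

/-- A hard Lefschetz datum of a smooth projective `n`-fold (the tree's `HardLefschetzNFold n X`:
hyperplane class `[H]`, rational, supported on the divisor `H`, with hard Lefschetz in dimension
`n`) is in particular a polarisation class in the sense of `IsPolarizationClass` (its first three
fields). [cite: VoisinHodgeI2002, Thm. 6.25, Rem. 6.27 and §7.1.2] [cite: Andre1996Motifs, §1.1 (p. 10)] -/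
theorem HardLefschetzNFold.isPolarizationClass (Λ : HardLefschetzNFold n X) :
    IsPolarizationClass n X Λ.hyperplaneClass :=
  ⟨Λ.isRationalClass_hyperplaneClass, Λ.hyperplaneClass_mem, Λ.hasHardLefschetz⟩

/-- **Algebraic classes are generators of `A_mot(X)`** (André 1996, §2.1, remark after Déf. 1:
"Il est clair que `A_mot(X)_E` contient `A(X)`"), on the real carriers and in the constructor form
of `IsMotivatedClass`: for `X` smooth projective of dimension `n`, a polarisation class `η` of
`X ⊗ X`, `p ≤ n` and `c ∈ Nᵖ H²ᵖ(X(ℂ); ℂ) = algebraicClasses X p`, the class `c` is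
`pr_{1*}(α ∪ *_L β)` with `Y := X`, `α := pr₁^* c ∈ Nᵖ H²ᵖ((X ⊗ X)(ℂ))`, `β := Δ_* 1 ∈ Nⁿ H²ⁿ((X ⊗ X)(ℂ))`
(`Δ` the diagonal), `*_L = L⁰ = id` in the middle degree `2n`, and
`pr_{1*}(pr₁^* c ∪ Δ_* 1) = c ∪ (Δ ≫ pr₁)_* 1 = c ∪ 1 = c` (projection formula and functoriality of
Gysin maps, Fulton App. B §B.1 (2), (5), (6)); the orientations are any `ℂ`-orientations of `X(ℂ)`,
`(X ⊗ X)(ℂ)` (`Motives.ComplexPoints.isOrientableOver`), which satisfy Poincaré duality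
(`OrientationFamily.hasPoincareDuality`). [cite: Andre1996Motifs, §2.1 remark following Déf. 1 (p. 14)]
[cite: FultonYoungTableaux1997, Appendix B §B.1 (2), (5), (6) and §B.2 Exercise 5] -/
theorem isMotivatedClass_of_mem_algebraicClasses (hX : Motives.IsSmoothProjective n X)
    {η : complexBetti (X ⊗ X) 2} (hη : IsPolarizationClass (n + n) (X ⊗ X) η) {p : ℕ} (hp : p ≤ n)
    {c : complexBetti X (2 * p)} (hc : c ∈ algebraicClasses X p) : IsMotivatedClass n X p c := by
  classical
  have hXX : Motives.IsSmoothProjective (n + n) (X ⊗ X) :=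
    Motives.IsSmoothProjective.tensor_holds hX hX
  -- the diagonal, a section of `pr₁`
  obtain ⟨Δ, hΔfst⟩ : ∃ Δ : X ⟶ X ⊗ X, Δ ≫ fst X X = 𝟙 X := ⟨lift (𝟙 X) (𝟙 X), lift_fst _ _⟩
  -- `ℂ`-orientations of all `Z(ℂ)`, `Z` smooth projective, with Poincaré duality
  obtain ⟨μ, hμ⟩ : ∃ μ : OrientationFamily, μ.HasPoincareDuality :=
    ⟨fun _ _ h ↦ Classical.choice (Motives.ComplexPoints.isOrientableOver ℂ h),
      OrientationFamily.hasPoincareDuality _⟩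
  -- `β = Δ_* 1`, an algebraic class of codimension `n` on `X ⊗ X`
  have hΔ : 0 + 2 * (n + n) = 2 * n + 2 * n := by omega
  obtain ⟨β, hβdef⟩ : ∃ β : complexBetti (X ⊗ X) (2 * n),
      β = complexGysin μ hX hXX Δ hΔ (singularCohomology.one ℂ (Motives.ComplexPoints X)) := ⟨_, rfl⟩
  have hΔcl : IsClosedMap Δ.left.base :=
    haveI := isProper_left_of_isSmoothProjective hX hXX Δ
    Δ.left.isClosedMap
  have hβ : β ∈ algebraicClasses (X ⊗ X) n := by
    rw [hβdef]
    refine mem_supportedClasses_of_restrictCompl_eq_zero hΔcl.isClosed_range (fun z hz ↦ ?_) ?_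
    · rw [← Set.image_univ] at hz
      exact le_coheight_of_mem_image hX hXX Δ hΔcl (S := Set.univ) (r := 0) (s := n)
        (fun _ _ ↦ by simp) (by omega) hz
    · exact restrictCompl_complexGysin_eq_zero (gysinMap_restrictCompl_eq_zero_of_field ℂ) μ hμ hXX
        hX Δ hΔcl.isClosed_range subset_rfl hΔ _
  -- `α = pr₁^* c`, an algebraic class of codimension `p` on `X ⊗ X`
  have hα : complexBetti.map (fst X X) (2 * p) c ∈ algebraicClasses (X ⊗ X) p :=
    map_fst_mem_supportedClasses hX hX hc
  refine ⟨n, X, hX, μ hXX, μ hX, hμ hXX, hμ hX, η, hη, p, n, n, n - p, rfl, rfl, by omega,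
    complexBetti.map (fst X X) (2 * p) c, β, hα, hβ, ?_⟩
  -- `*_L β = β` in the middle degree `2n`
  have hstar : ∀ h4 : 2 * n + 2 * n = 2 * (n + n),
      lefschetzInvolution hη.hasHardLefschetz h4 β = β := by
    intro h4
    have h := lefschetzInvolution_apply_of_le hη.hasHardLefschetz (a := 2 * n) (j := 0) (by omega) h4 β
    rw [lefschetzPow_zero, LinearMap.id_apply] at h
    exact h
  rw [hstar]
  -- `pr_{1*}` as the Gysin morphism of the orientation family, and the projection formula
  rw [← complexGysin_eq_gysinMap hXX hX (fst X X)
    (show 2 * (p + n) + 2 * n = 2 * p + 2 * (n + n) by omega)]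
  rw [complexGysin_cup hμ hXX hX (fst X X) _ _ (show 2 * n + 2 * n = 0 + 2 * (n + n) by omega)
    (Nat.add_zero _)]
  -- `pr_{1*} Δ_* 1 = (Δ ≫ pr₁)_* 1 = 𝟙_* 1 = 1`
  have hcomp := complexGysin_comp hμ hX hXX hX Δ (fst X X) hΔ
    (show 2 * n + 2 * n = 0 + 2 * (n + n) by omega)
  rw [hΔfst, complexGysin_id hμ hX 0] at hcomp
  have h1 : complexGysin μ hXX hX (fst X X) (show 2 * n + 2 * n = 0 + 2 * (n + n) by omega) β =
      singularCohomology.one ℂ (Motives.ComplexPoints X) := by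
    have h := LinearMap.congr_fun hcomp (singularCohomology.one ℂ (Motives.ComplexPoints X))
    rw [LinearMap.comp_apply, LinearMap.id_apply, ← hβdef] at h
    exact h.symm
  rw [h1, cupProduct_one]

/-- **`A(X) ⊆ A_mot(X)`** (André 1996, §2.1, remark following Déf. 1, p. 14: "Il est clair que
`A_mot(X)_E` contient `A(X)`"), on the real carriers: for `X` smooth projective of dimension `n` over
`ℂ` and a polarisation class `η` of `X ⊗ X` (a choice Déf. 1 requires; hard Lefschetz),
`Nᵖ H²ᵖ(X(ℂ); ℂ) = algebraicClasses X p ≤ motivatedClasses n X p = A_motᵖ(X)_ℂ` for every `p`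
(for `p ≤ n` by `isMotivatedClass_of_mem_algebraicClasses`; for `p > n`, `H²ᵖ(X(ℂ); ℂ) = 0`).
[cite: Andre1996Motifs, §2.1 remark following Déf. 1 (p. 14)] -/
theorem algebraicClasses_le_motivatedClasses (hX : Motives.IsSmoothProjective n X)
    {η : complexBetti (X ⊗ X) 2} (hη : IsPolarizationClass (n + n) (X ⊗ X) η) (p : ℕ) :
    algebraicClasses X p ≤ motivatedClasses n X p := by
  intro c hc
  by_cases hp : p ≤ n
  · exact (isMotivatedClass_of_mem_algebraicClasses hX hη hp hc).mem_motivatedClasses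
  · haveI := subsingleton_complexBetti hX (show 2 * n < 2 * p by omega)
    rw [Subsingleton.elim c 0]
    exact Submodule.zero_mem _

/-- **`A(X) ⊆ A_mot(X)` from hard Lefschetz** (André 1996, §2.1 remark; Voisin I Thm. 6.25): granted
the tree's named fact `nonempty_hardLefschetzNFold (n + n) (X ⊗ X)` (the smooth projective `2n`-fold
`X ⊗ X` carries a hard Lefschetz datum, in particular a polarisation class),
`algebraicClasses X p ≤ motivatedClasses n X p` for `X` smooth projective of dimension `n` and every
`p`. [cite: Andre1996Motifs, §2.1 remark following Déf. 1 (p. 14)] [cite: VoisinHodgeI2002, Thm. 6.25 and Rem. 6.27] -/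
theorem algebraicClasses_le_motivatedClasses_of_nonempty_hardLefschetzNFold
    (hX : Motives.IsSmoothProjective n X) (hHL : nonempty_hardLefschetzNFold (n + n) (X ⊗ X)) (p : ℕ) :
    algebraicClasses X p ≤ motivatedClasses n X p := by
  obtain ⟨Λ⟩ := hHL (Motives.IsSmoothProjective.tensor_holds hX hX)
  exact algebraicClasses_le_motivatedClasses hX Λ.isPolarizationClass p

end Motivated

/-! ### The deformation step of the proof of Thm. 0.6.2 (§6.3): an algebraic fibre motivates all fibres -/

section Deformation

/-- **The use of Thm. 0.5 in the proof of Thm. 0.6.2** (André 1996, §6.3, p. 33: each of Lemmes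
6.3.1, 6.3.3 produces a pencil `f : X → S` and a global section of `R²ᵖ f_* ℚ(p)` whose fibre at
one point `s₀` is ALGEBRAIC (6.3.3 (iii): "dont la fibre en `s₀` soit algébrique"), and "Comme
l'affirme alors le théorème 0.5 appliqué au cas particulier d'un pinceau compact de variétés
abéliennes, les cycles motivés sont préservés par déformation plate dans le pinceau […] les lemmes
précédents entraînent immédiatement le théorème 0.6.2"), on the real carriers and in the
global-class form of the tree's named fact `Andre1996_deformation` (Thm. 0.5, granted as `h`): for a
smooth projective family `f : 𝒳 ⟶ S` of relative dimension `n`, projective in Hartshorne's sense,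
over a reduced connected `ℂ`-scheme of finite type, and a global class `A ∈ H²ᵖ(𝒳(ℂ); ℂ)` whose
restriction to ONE fibre `𝒳_{s₀}` is algebraic, the restriction to EVERY fibre is motivated — the
algebraic fibre is motivated by `A(𝒳_{s₀}) ⊆ A_mot(𝒳_{s₀})`
(`algebraicClasses_le_motivatedClasses_of_nonempty_hardLefschetzNFold`, granted the hard Lefschetz
datum of `𝒳_{s₀} ⊗ 𝒳_{s₀}`, the tree's named fact `nonempty_hardLefschetzNFold`), and Thm. 0.5
deforms it. [cite: Andre1996Motifs, §6.3 (p. 33) and Thm. 0.5 (p. 8)] -/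
theorem Andre1996_deformation.map_fiber_mem_motivatedClasses_of_mem_algebraicClasses
    (h : Andre1996_deformation) ⦃n : ℕ⦄ ⦃𝒳 S : Motives.SchemeOver ℂ⦄ (f : 𝒳 ⟶ S)
    (hf : Motives.IsSmoothProjectiveFamily f n)
    (hproj : ∃ (N : ℕ) (ι : 𝒳 ⟶ Motives.projectiveSpace N ℂ ⊗ S),
      IsClosedImmersion ι.left ∧ ι ≫ snd (Motives.projectiveSpace N ℂ) S = f)
    (hred : IsReduced S.left) (hconn : ConnectedSpace S.left) (hft : LocallyOfFiniteType S.hom)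
    (hqc : QuasiCompact S.hom) (p : ℕ) (A : complexBetti 𝒳 (2 * p)) (s₀ : Motives.ComplexPoints S)
    (hHL : nonempty_hardLefschetzNFold (n + n) (Motives.fiberOver f s₀ ⊗ Motives.fiberOver f s₀))
    (hA : complexBetti.map (Motives.fiberι f s₀) (2 * p) A ∈ algebraicClasses (Motives.fiberOver f s₀) p)
    (s : Motives.ComplexPoints S) :
    complexBetti.map (Motives.fiberι f s) (2 * p) A ∈ motivatedClasses n (Motives.fiberOver f s) p :=
  h f hf hproj hred hconn hft hqc p A s₀
    (algebraicClasses_le_motivatedClasses_of_nonempty_hardLefschetzNFold (hf.isSmoothProjective s₀)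
      hHL p hA) s

end Deformation

/-! ### The graph of a morphism: `f^*` and `f_*` are algebraic correspondences (André 1996, §2.1, p. 15) -/

section Graph

variable {m n : ℕ} {X' X : Motives.SchemeOver ℂ}

/-- **The graph class is algebraic**: for `f : X' ⟶ X` (`X'`, `X` smooth projective of dimensions
`m`, `n`) the class `[Γ_f] := (𝟙, f)_* 1 ∈ H²ⁿ((X' ⊗ X)(ℂ); ℂ)` of the graph
`Γ_f = (𝟙, f)(X') ⊂ X' × X` (a smooth subvariety of codimension `n`) lies in
`Nⁿ H²ⁿ((X' ⊗ X)(ℂ); ℂ) = algebraicClasses (X' ⊗ X) n` ("la classe du graphe de `f`", André 1996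
§2.1 p. 15): a Gysin image dies off the Zariski-closed image, all of whose points have codimension
`≥ n` (the tree's `complexGysin_mem_supportedClasses`, Fulton App. B §B.2 Ex. 5, fed with the PROVED
support fact `gysinMap_restrictCompl_eq_zero_of_field ℂ` and `1 ∈ N⁰ H⁰ = H⁰`). This is the class
"`[V]` in `H^{2c}X`" of the smooth subvariety `V = Γ_f` (Fulton App. B §B.3).
[cite: Andre1996Motifs, §2.1 (p. 15)] [cite: FultonYoungTableaux1997, Appendix B §B.2 Exercise 5 and §B.3] -/
theorem complexGysin_graph_one_mem_algebraicClasses (μ : OrientationFamily) (hμ : μ.HasPoincareDuality)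
    (hX' : Motives.IsSmoothProjective m X') (hX'X : Motives.IsSmoothProjective (m + n) (X' ⊗ X))
    (f : X' ⟶ X) :
    complexGysin μ hX' hX'X (lift (𝟙 X') f) (show 0 + 2 * (m + n) = 2 * n + 2 * m by omega)
        (singularCohomology.one ℂ (Motives.ComplexPoints X')) ∈ algebraicClasses (X' ⊗ X) n :=
  complexGysin_mem_supportedClasses (gysinMap_restrictCompl_eq_zero_of_field ℂ) μ hμ hX' hX'X
    (lift (𝟙 X') f) _ (r := 0) (by omega) (by rw [supportedClasses_zero]; exact Submodule.mem_top)

/-- **The transposed graph class is algebraic**: for `f : X' ⟶ X` as above, the class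
`[ᵗΓ_f] := (f, 𝟙)_* 1 ∈ H²ⁿ((X ⊗ X')(ℂ); ℂ)` of the transposed graph `ᵗΓ_f = (f, 𝟙)(X') ⊂ X × X'`
(codimension `n`) lies in `algebraicClasses (X ⊗ X') n` ("ou sa transposée", André 1996 §2.1 p. 15;
same proof as for the graph). [cite: Andre1996Motifs, §2.1 (p. 15)]
[cite: FultonYoungTableaux1997, Appendix B §B.2 Exercise 5 and §B.3] -/
theorem complexGysin_transposeGraph_one_mem_algebraicClasses (μ : OrientationFamily)
    (hμ : μ.HasPoincareDuality) (hX' : Motives.IsSmoothProjective m X')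
    (hXX' : Motives.IsSmoothProjective (n + m) (X ⊗ X')) (f : X' ⟶ X) :
    complexGysin μ hX' hXX' (lift f (𝟙 X')) (show 0 + 2 * (n + m) = 2 * n + 2 * m by omega)
        (singularCohomology.one ℂ (Motives.ComplexPoints X')) ∈ algebraicClasses (X ⊗ X') n :=
  complexGysin_mem_supportedClasses (gysinMap_restrictCompl_eq_zero_of_field ℂ) μ hμ hX' hXX'
    (lift f (𝟙 X')) _ (r := 0) (by omega) (by rw [supportedClasses_zero]; exact Submodule.mem_top)

/-- **Pull-back is the action of the graph: `f^* = [Γ_f]^*`** (André 1996, §2.1, p. 15: "On obtient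
le formalisme `f^*`, `f_*` (pour un morphisme `f`) en composant les correspondances motivées avec la
classe du graphe de `f` ou sa transposée"; Voisin II (10.7) with `α = [Γ_f]`), on the
real carriers: for `f : X' ⟶ X` of smooth projective complex varieties of
dimensions `m`, `n`, an orientation family `μ` with Poincaré duality, and `c ∈ Hᵃ(X(ℂ); ℂ)`
(`a + q = 2m`), `[Γ_f]^*(c) = pr_{X'*}(pr_X^* c ∪ (𝟙, f)_* 1) = f^* c` (`corrClassAction` of
`HodgeTheory/MotivatedClasses`, `pr_{X'*} = gysinMap (μ_{X' ⊗ X}) (μ_{X'}) pr_{X'}(ℂ)`). Proof: with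
`g = (𝟙, f)`, `pr_X^* c ∪ g_* 1 = g_*(g^* pr_X^* c ∪ 1) = g_*(f^* c)` (projection formula,
`g ≫ pr_X = f`) and `pr_{X'*} g_* = (g ≫ pr_{X'})_* = (𝟙)_* = id` (Fulton App. B §B.1 (2), (5), (6):
the tree's `complexGysin_cup`, `complexGysin_comp`, `complexGysin_id`). This identity is the bridge
from the composition of motivated correspondences (Prop. 2.1 and its Corollaire) to the stability
of motivated classes under `f^*` invoked in the proof of Thm. 0.6.2 (§6.3, p. 33: "les cycles motivés
sont aussi préservés par image inverse par un morphisme"). [cite: Andre1996Motifs, §2.1 (p. 15)]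
[cite: VoisinHodgeII2003, proof of Thm. 10.17 (10.7)]
[cite: FultonYoungTableaux1997, Appendix B §B.1 (2), (5), (6)] -/
theorem corrClassAction_graph (μ : OrientationFamily) (hμ : μ.HasPoincareDuality)
    (hX' : Motives.IsSmoothProjective m X') (hX'X : Motives.IsSmoothProjective (m + n) (X' ⊗ X))
    (f : X' ⟶ X) {a q : ℕ} (hq : a + q = 2 * m) (c : complexBetti X a) :
    corrClassAction (μ hX'X) (μ hX') (rfl : a + 2 * n = a + 2 * n) hq
        (complexGysin μ hX' hX'X (lift (𝟙 X') f) (show 0 + 2 * (m + n) = 2 * n + 2 * m by omega)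
          (singularCohomology.one ℂ (Motives.ComplexPoints X')))
        c =
      complexBetti.map f a c := by
  rw [corrClassAction_apply]
  -- `pr_{X'*}` as the Gysin morphism of the orientation family
  rw [← complexGysin_eq_gysinMap hX'X hX' (fst X' X)
    (show a + 2 * n + 2 * m = a + 2 * (m + n) by omega)]
  -- projection formula for `g = (𝟙, f)`: `pr_X^* c ∪ g_* 1 = g_* (g^* pr_X^* c ∪ 1) = g_* (g^* pr_X^* c)`
  rw [← complexGysin_cup hμ hX' hX'X (lift (𝟙 X') f) (Nat.add_zero a)
    (show a + 2 * (m + n) = a + 2 * n + 2 * m by omega)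
    (show 0 + 2 * (m + n) = 2 * n + 2 * m by omega) rfl, cupProduct_one]
  -- `g^* pr_X^* = (g ≫ pr_X)^* = f^*`
  have hgs : (complexBetti.map (lift (𝟙 X') f) a) ((complexBetti.map (snd X' X) a) c) =
      complexBetti.map f a c := by
    have h := complexBetti.map_comp (lift (𝟙 X') f) (snd X' X) a
    rw [lift_snd] at h
    rw [h, CategoryTheory.comp_apply]
  rw [hgs]
  -- `pr_{X'*} ∘ g_* = (g ≫ pr_{X'})_* = (𝟙 X')_* = id`
  have hcomp := complexGysin_comp hμ hX' hX'X hX' (lift (𝟙 X') f) (fst X' X)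
    (show a + 2 * (m + n) = a + 2 * n + 2 * m by omega)
    (show a + 2 * n + 2 * m = a + 2 * (m + n) by omega)
  rw [lift_fst, complexGysin_id hμ hX' a] at hcomp
  have h := LinearMap.congr_fun hcomp (complexBetti.map f a c)
  rw [LinearMap.comp_apply, LinearMap.id_apply] at h
  exact h.symm

/-- **`f^*` is induced by an algebraic correspondence** (André 1996 §2.1, p. 15; the graph
`[Γ_f] ∈ Nⁿ H²ⁿ((X' ⊗ X)(ℂ))` acts as `f^*`, `corrClassAction_graph`): for `f : X' ⟶ X` of smooth
projective complex varieties of dimensions `m`, `n` and every degree `a ≤ 2m` (above `2m = dim_ℝ X'(ℂ)`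
the target `Hᵃ(X'(ℂ); ℂ)` is `0` and the degree bookkeeping of `IsAlgebraicCorrespondence` is void),
`f^* : Hᵃ(X(ℂ); ℂ) → Hᵃ(X'(ℂ); ℂ)` satisfies `IsAlgebraicCorrespondence m n X' X` — relative to any
`ℂ`-orientations of `X'(ℂ)`, `(X' ⊗ X)(ℂ)` (`Motives.ComplexPoints.isOrientableOver`), which satisfy
Poincaré duality (`OrientationFamily.hasPoincareDuality`). [cite: Andre1996Motifs, §2.1 (p. 15)]
[cite: VoisinHodgeII2003, proof of Thm. 10.17 (10.7)] -/
theorem isAlgebraicCorrespondence_map (hX' : Motives.IsSmoothProjective m X')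
    (hX : Motives.IsSmoothProjective n X) (f : X' ⟶ X) {a : ℕ} (ha : a ≤ 2 * m) :
    IsAlgebraicCorrespondence m n X' X (complexBetti.map f a).hom := by
  obtain ⟨μ, hμ⟩ : ∃ μ : OrientationFamily, μ.HasPoincareDuality :=
    ⟨fun _ _ h ↦ Classical.choice (Motives.ComplexPoints.isOrientableOver ℂ h),
      OrientationFamily.hasPoincareDuality _⟩
  have hX'X : Motives.IsSmoothProjective (m + n) (X' ⊗ X) :=
    Motives.IsSmoothProjective.tensor_holds hX' hX
  have hq : a + (2 * m - a) = 2 * m := by omega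
  exact ⟨μ hX'X, μ hX', hμ hX'X, hμ hX', n, 2 * m - a, rfl, hq, _,
    complexGysin_graph_one_mem_algebraicClasses μ hμ hX' hX'X f,
    LinearMap.ext fun c ↦ corrClassAction_graph μ hμ hX' hX'X f hq c⟩

/-- **Push-forward is the action of the transposed graph: `f_* = [ᵗΓ_f]^*`** (André 1996, §2.1,
p. 15: "… ou sa transposée"), on the real carriers: for `f : X' ⟶ X` of smooth projective complex
varieties of dimensions `m`, `n`, an orientation family `μ` with Poincaré duality and
`c' ∈ Hᵃ(X'(ℂ); ℂ)` (`a + 2n = b + 2m`, `b + q = 2n`),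
`[ᵗΓ_f]^*(c') = pr_{X*}(pr_{X'}^* c' ∪ (f, 𝟙)_* 1) = f_* c'` (`complexGysin μ`). Proof: with
`h = (f, 𝟙)`, `pr_{X'}^* c' ∪ h_* 1 = h_*(h^* pr_{X'}^* c') = h_* c'` (`h ≫ pr_{X'} = 𝟙`) and
`pr_{X*} h_* = (h ≫ pr_X)_* = f_*`. [cite: Andre1996Motifs, §2.1 (p. 15)]
[cite: FultonYoungTableaux1997, Appendix B §B.1 (2), (5), (6)] -/
theorem corrClassAction_transposeGraph (μ : OrientationFamily) (hμ : μ.HasPoincareDuality)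
    (hX' : Motives.IsSmoothProjective m X') (hX : Motives.IsSmoothProjective n X)
    (hXX' : Motives.IsSmoothProjective (n + m) (X ⊗ X')) (f : X' ⟶ X) {a b q : ℕ}
    (hab : a + 2 * n = b + 2 * m) (hq : b + q = 2 * n) (c' : complexBetti X' a) :
    corrClassAction (μ hXX') (μ hX) hab hq
        (complexGysin μ hX' hXX' (lift f (𝟙 X')) (show 0 + 2 * (n + m) = 2 * n + 2 * m by omega)
          (singularCohomology.one ℂ (Motives.ComplexPoints X')))
        c' =
      complexGysin μ hX' hX f hab c' := by
  rw [corrClassAction_apply]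
  rw [← complexGysin_eq_gysinMap hXX' hX (fst X X')
    (show a + 2 * n + 2 * n = b + 2 * (n + m) by omega)]
  rw [← complexGysin_cup hμ hX' hXX' (lift f (𝟙 X')) (Nat.add_zero a)
    (show a + 2 * (n + m) = a + 2 * n + 2 * m by omega)
    (show 0 + 2 * (n + m) = 2 * n + 2 * m by omega) rfl, cupProduct_one]
  -- `h^* pr_{X'}^* = (h ≫ pr_{X'})^* = 𝟙`
  have hgs : (complexBetti.map (lift f (𝟙 X')) a) ((complexBetti.map (snd X X') a) c') = c' := by
    have h := (CategoryTheory.comp_apply (complexBetti.map (snd X X') a)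
      (complexBetti.map (lift f (𝟙 X')) a) c').symm
    rw [← complexBetti.map_comp, lift_snd, complexBetti.map_id] at h
    exact h
  rw [hgs]
  -- `pr_{X*} ∘ h_* = (h ≫ pr_X)_* = f_*`
  have hcomp := complexGysin_comp hμ hX' hXX' hX (lift f (𝟙 X')) (fst X X')
    (show a + 2 * (n + m) = a + 2 * n + 2 * m by omega)
    (show a + 2 * n + 2 * n = b + 2 * (n + m) by omega)
  rw [lift_fst] at hcomp
  have h := LinearMap.congr_fun hcomp c'
  rw [LinearMap.comp_apply] at h
  exact h.symm

/-- **`f_*` is induced by an algebraic correspondence** (André 1996 §2.1, p. 15; the transposed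
graph acts as `f_*`, `corrClassAction_transposeGraph`): for `f : X' ⟶ X` of smooth projective complex
varieties of dimensions `m`, `n`, an orientation family `μ` with Poincaré duality and degrees
`a + 2n = b + 2m`, `b + q = 2n`, the Gysin morphism `f_* = complexGysin μ : Hᵃ(X'(ℂ); ℂ) → Hᵇ(X(ℂ); ℂ)`
satisfies `IsAlgebraicCorrespondence n m X X'`. [cite: Andre1996Motifs, §2.1 (p. 15)]
[cite: FultonYoungTableaux1997, Appendix B §B.1 (5)] -/
theorem isAlgebraicCorrespondence_complexGysin (μ : OrientationFamily) (hμ : μ.HasPoincareDuality)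
    (hX' : Motives.IsSmoothProjective m X') (hX : Motives.IsSmoothProjective n X) (f : X' ⟶ X)
    {a b q : ℕ} (hab : a + 2 * n = b + 2 * m) (hq : b + q = 2 * n) :
    IsAlgebraicCorrespondence n m X X' (complexGysin μ hX' hX f hab) :=
  have hXX' : Motives.IsSmoothProjective (n + m) (X ⊗ X') :=
    Motives.IsSmoothProjective.tensor_holds hX hX'
  ⟨μ hXX', μ hX, hμ hXX', hμ hX, n, q, hab, hq, _,
    complexGysin_transposeGraph_one_mem_algebraicClasses μ hμ hX' hXX' f,
    LinearMap.ext fun c' ↦ corrClassAction_transposeGraph μ hμ hX' hX hXX' f hab hq c'⟩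

end Graph

end HodgeTheory

end Literature.AlgebraicGeometry.HodgeTheory

end
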